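import Summits.HubbardSuperconductivity.HubbardSuperconductivity.Theses.PlaquetteBoson
import Summits.HubbardSuperconductivity.HubbardSuperconductivity.Theorems.TwTipContinuation.Negative.TipNormalForm
import HarnessLib

/-!
# Crux `PbContinuation` (stmt-HubbardSuperconductivity-0907) — crux-ideate round 1, ideator k = 2:
# kernel-checked companion of `IdeationR1K2.md` (NO proof line filed; structural reasons)

Contents (all sorry-free):

* `AnchorAt U δ`, `SummitAt U δ` — the antecedent / consequent of the crux at one `(U,δ)`, verbatim;
  `pbContinuation_iff : PbContinuation ↔ ∀ U δ, 0 < U → δ ∈ (0,1/2) → AnchorAt U δ → SummitAt U δ`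
  (`Iff.rfl`): the crux is the POINTWISE implication, universally closed over ALL `(U,δ)`.
* `not_pbContinuation_of_corner` — ONE point `(U,δ)` with anchor-type small-`t'` order and WITHOUT the
  summit matrix refutes the crux; `not_pbContinuation_of_weakCouplingCorner` — the typed physical
  wedge: (H₂) "at weak coupling the uniform ground state is not `d_{x²-y²}` for `δ ∈ (2/5,1/2)`"
  (Deng–Kozik–Prokof'ev–Svistunov 2015, arXiv:1408.2088 p. 1–2: `d_xy` / `p` for `0.5 < n < 0.6`,
  near-vertical `d_xy/d_{x²-y²}` boundary at `n ≈ 0.6` for `U ≤ 4`) together with (H₁) "the plaquette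
  programme's own all-fillings engine puts anchor order at some such `(U,δ)`" gives `¬ PbContinuation`.
  Neither H₁ nor H₂ is provable today; the theorem is the NEGATIVE-LEMMA SHAPE a disprover would land
  (`H₁ → H₂ → ¬PbContinuation`) and the reason tenure must restate the crux to a `(U,δ)` window /
  two-place predicate before any line can conclude it by name.
* `not_abstractContinuationShape` — the MODEL-FREE shape of the crux ("every ground state of
  `A + t V` is lit for all small `t > 0` ⟹ every ground state of `A + V` is lit", `P ≥ 0`) is false:
  `2 × 2` level crossing. Companion of `TwTipContinuation.Negative.not_abstractTipShape`.
* `not_abstractTwoEndedShape` — even the TWO-ENDED shape suggested by the breathing self-duality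
  `H(a,b,U) ≅ H(b,a,U)` ("lit near BOTH arms `(1,t)` and `(t,1)` for all small `t` ⟹ lit at the
  self-dual point `(1,1)`") is false abstractly: `3 × 3` example. So the duality adds no continuation
  principle by itself.

Nothing here is a route item; no definition is proposed for the tree.
-/

noncomputable section

set_option linter.dupNamespace false

namespace Summit.HubbardSuperconductivity.HubbardSuperconductivity.Cruxes.PbContinuation.IdeationR1K2

open Matrix Filter
open Literature.Probability.LatticeModels Literature.MathematicalPhysics.QuantumLattice
open Summit.HubbardSuperconductivity.HubbardSuperconductivity.Theses.PlaquetteBoson (PbContinuation)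

/-! ## 1. The crux is a pointwise implication closed over all `(U,δ)` -/

/-- Anchor-type order at `(U,δ)`: the antecedent of `PbContinuation`, verbatim (checkerboard Hubbard
torus `H_L(t',U)`, every `(N_L, S^z=0)`-sector ground state has `c(t') L⁴ ≤ Re⟨ψ, Δ_d†Δ_d ψ⟩` for all
small `t'`, eventually in `L ∈ 4ℕ`). [folklore] -/
def AnchorAt (U δ : ℝ) : Prop :=
  ∃ t₀ : ℝ, 0 < t₀ ∧ ∀ t' ∈ Set.Ioo (0:ℝ) t₀, ∃ c : ℝ, 0 < c ∧ ∃ L₀ : ℕ, ∀ (L : ℕ) [NeZero L],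
    L₀ ≤ L → 4 ∣ L → ∀ (N : ℕ) (ψ : Fock (Orb (FermionTorus 2 L))),
      N = 2 * ⌊(1 - δ) * (L : ℝ) ^ 2 / 2⌋₊ → star ψ ⬝ᵥ ψ = 1 →
      IsGroundStateInSector
        (hamiltonian ((fermionTorusGraph 2 L) \ SimpleGraph.comap
            (fun x : FermionTorus 2 L => fun i : Fin 2 => ((ofLex x) i : ℕ) / 2) ⊤) 1 U +
          hamiltonian ((fermionTorusGraph 2 L) ⊓ SimpleGraph.comap
            (fun x : FermionTorus 2 L => fun i : Fin 2 => ((ofLex x) i : ℕ) / 2) ⊤) t' 0) N 0 ψ →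
      c * (L : ℝ) ^ 4 ≤ (expect ((pairField dWaveFormFactor L)ᴴ * pairField dWaveFormFactor L) ψ).re

/-- The summit's matrix at `(U,δ)`: the consequent of `PbContinuation`, verbatim. [folklore] -/
def SummitAt (U δ : ℝ) : Prop :=
  ∀ (N : ℕ → ℕ) (ψ : ∀ L, Fock (Orb (FermionTorus 2 L))),
    (∀ L, Even L → N L = 2 * ⌊(1 - δ) * (L : ℝ) ^ 2 / 2⌋₊ ∧ star (ψ L) ⬝ᵥ ψ L = 1 ∧
        IsGroundStateInSector (hubbardTorus 2 L 1 U) (N L) 0 (ψ L)) →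
      HasLongRangeOrder (fun k => halfOpenBox 2 (2 * k))
        (fun k => torusPullback (pairFieldCorr dWaveFormFactor ψ) (2 * k))

/-- **Normal form.** `PbContinuation` is literally the pointwise implication `AnchorAt → SummitAt`
closed over ALL `U > 0`, `δ ∈ (0,1/2)`. [folklore] -/
theorem pbContinuation_iff :
    PbContinuation ↔ ∀ (U δ : ℝ), 0 < U → δ ∈ Set.Ioo (0:ℝ) (1/2) → AnchorAt U δ → SummitAt U δ :=
  Iff.rfl

/-- The consequent in every-ground-state form (landed normal form, `δ ≥ -1`). [folklore] -/
theorem summitAt_iff_everyGSOrder {U δ : ℝ} (hδ : -1 ≤ δ) :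
    SummitAt U δ ↔
      (∃ c : ℝ, 0 < c ∧ ∃ L₀ : ℕ, ∀ (L : ℕ) [NeZero L], L₀ ≤ L → Even L →
        ∀ ψ : Fock (Orb (FermionTorus 2 L)), star ψ ⬝ᵥ ψ = 1 →
          IsGroundStateInSector (hubbardTorus 2 L 1 U) (2 * ⌊(1 - δ) * (L : ℝ) ^ 2 / 2⌋₊) 0 ψ →
            c * (L : ℝ) ^ 4 ≤ (expect ((pairField dWaveFormFactor L)ᴴ * pairField dWaveFormFactor L) ψ).re) :=
  Summit.HubbardSuperconductivity.TwTipContinuation.Negative.summitMatrix_iff_everyGSOrder hδ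

/-! ## 2. The corner wedge (negative-lemma shape) -/

/-- **Corner wedge.** One point `(U,δ)` carrying anchor-type order but not the summit matrix refutes
the crux as typed. [folklore] -/
theorem not_pbContinuation_of_corner {U δ : ℝ} (hU : 0 < U) (hδ : δ ∈ Set.Ioo (0:ℝ) (1/2))
    (hA : AnchorAt U δ) (hN : ¬ SummitAt U δ) : ¬ PbContinuation :=
  fun h => hN (h U δ hU hδ hA)

/-- (H₂) **Weak-coupling non-`B₁g` corner**: below some `U₁`, for hole dopings `δ ∈ (2/5, 1/2)`
(electron density `0.5 < n < 0.6`), the summit matrix FAILS — some admissible ground-state sequence of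
the uniform torus has no `d_{x²-y²}` pair-field LRO (physically: the `d_xy` / `p` BCS ground state;
Deng–Kozik–Prokof'ev–Svistunov, EPL 110 (2015) 57001, arXiv:1408.2088 pp. 1–2;
Raghu–Kivelson–Scalapino PRB 81 (2010) 224505). Not proved; typed hypothesis. [conjecture] -/
def WeakCouplingNonB1gCorner (U₁ : ℝ) : Prop :=
  ∀ U ∈ Set.Ioo (0:ℝ) U₁, ∀ δ ∈ Set.Ioo (2/5 : ℝ) (1/2), ¬ SummitAt U δ

/-- (H₁) **Anchor in the corner**: the plaquette-boson engine (hole-pair hard-core bosons at filling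
`2δ`, `PbParticleHole` + `PbInterpolation` + a dressing lemma) places anchor-type small-`t'` order at
SOME `(U,δ)` with `U < U₁`, `δ ∈ (2/5,1/2)` (boson filling `∈ (0.8, 1)`, i.e. dilute boson vacancies).
Not proved (the dressing lemma and off-half-filling hard-core BEC are open); typed hypothesis.
[conjecture] -/
def AnchorInCorner (U₁ : ℝ) : Prop :=
  ∃ U ∈ Set.Ioo (0:ℝ) U₁, ∃ δ ∈ Set.Ioo (2/5 : ℝ) (1/2), AnchorAt U δ

/-- **The typed physical obstruction**: H₂ and H₁ at a common `U₁` refute `PbContinuation`.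
(Negative-lemma shape `H₁ → H₂ → ¬crux`; both hypotheses open.) [folklore] -/
theorem not_pbContinuation_of_weakCouplingCorner {U₁ : ℝ}
    (h₂ : WeakCouplingNonB1gCorner U₁) (h₁ : AnchorInCorner U₁) : ¬ PbContinuation := by
  obtain ⟨U, hU, δ, hδ, hA⟩ := h₁
  have hδ' : δ ∈ Set.Ioo (0:ℝ) (1/2) := ⟨by linarith [hδ.1], hδ.2⟩
  exact not_pbContinuation_of_corner hU.1 hδ' hA (h₂ U hU δ hδ)

/-- Conversely, what ANY proof of the crux must do at each point: produce the summit matrix or refute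
the anchor there (classical trichotomy, recorded for the line planners). [folklore] -/
theorem pbContinuation_pointwise (h : PbContinuation) {U δ : ℝ} (hU : 0 < U)
    (hδ : δ ∈ Set.Ioo (0:ℝ) (1/2)) : ¬ AnchorAt U δ ∨ SummitAt U δ := by
  by_cases hA : AnchorAt U δ
  · exact Or.inr (h U δ hU hδ hA)
  · exact Or.inl hA

/-! ## 3. The model-free continuation shape is false (2 × 2 level crossing) -/

theorem toy_form (t : ℝ) (v : Fin 2 → ℝ) :
    v ⬝ᵥ (Matrix.diagonal ![(0 : ℝ), 1] + t • Matrix.diagonal ![(0 : ℝ), -2]) *ᵥ v =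
      (1 - 2 * t) * v 1 ^ 2 := by
  simp [Matrix.mulVec, dotProduct, Fin.sum_univ_two, Matrix.diagonal, Matrix.add_apply]
  ring

theorem toy_formP (v : Fin 2 → ℝ) : v ⬝ᵥ Matrix.diagonal ![(1 : ℝ), 0] *ᵥ v = v 0 ^ 2 := by
  simp [Matrix.mulVec, dotProduct, Fin.sum_univ_two, Matrix.diagonal]
  ring

theorem toy_form1 (v : Fin 2 → ℝ) :
    v ⬝ᵥ (Matrix.diagonal ![(0 : ℝ), 1] + Matrix.diagonal ![(0 : ℝ), -2]) *ᵥ v = - v 1 ^ 2 := by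
  simp [Matrix.mulVec, dotProduct, Fin.sum_univ_two, Matrix.diagonal, Matrix.add_apply]
  ring

theorem toy_norm (v : Fin 2 → ℝ) : v ⬝ᵥ v = v 0 ^ 2 + v 1 ^ 2 := by
  simp [dotProduct, Fin.sum_univ_two]
  ring

/-- **The abstract continuation shape is FALSE.** There are symmetric `A`, `V` and `P ≥ 0` on `ℝ²`
such that for all `t ∈ (0, 1/4)` every unit minimiser of `⟨v,(A + tV)v⟩` has `⟨v,Pv⟩ ≥ 1`, while a
unit minimiser of `⟨v,(A + V)v⟩` has `⟨v,Pv⟩ = 0` (`A = diag(0,1)`, `V = diag(0,-2)`, `P = diag(1,0)`: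
level crossing at `t = 1/2`). Hence no argument using only hermiticity, `P ≥ 0`, linearity and
concavity in `t'` and "order for ALL small `t'`" proves `PbContinuation`; a proof must use the
Hubbard family's structure. [folklore] -/
theorem not_abstractContinuationShape :
    ¬ (∀ (A V P : Matrix (Fin 2) (Fin 2) ℝ), P.PosSemidef →
        (∃ t₀ : ℝ, 0 < t₀ ∧ ∀ t ∈ Set.Ioo (0:ℝ) t₀, ∀ v : Fin 2 → ℝ,
          (v ⬝ᵥ v = 1 ∧ ∀ w : Fin 2 → ℝ, w ⬝ᵥ w = 1 →
              v ⬝ᵥ (A + t • V) *ᵥ v ≤ w ⬝ᵥ (A + t • V) *ᵥ w) → 1 ≤ v ⬝ᵥ P *ᵥ v) →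
        ∀ v : Fin 2 → ℝ, (v ⬝ᵥ v = 1 ∧ ∀ w : Fin 2 → ℝ, w ⬝ᵥ w = 1 →
            v ⬝ᵥ (A + V) *ᵥ v ≤ w ⬝ᵥ (A + V) *ᵥ w) → 0 < v ⬝ᵥ P *ᵥ v) := by
  intro h
  have hP : (Matrix.diagonal ![(1 : ℝ), 0]).PosSemidef :=
    Matrix.PosSemidef.diagonal (by intro i; fin_cases i <;> simp)
  have hlit : ∃ t₀ : ℝ, 0 < t₀ ∧ ∀ t ∈ Set.Ioo (0:ℝ) t₀, ∀ v : Fin 2 → ℝ,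
      (v ⬝ᵥ v = 1 ∧ ∀ w : Fin 2 → ℝ, w ⬝ᵥ w = 1 →
          v ⬝ᵥ (Matrix.diagonal ![(0 : ℝ), 1] + t • Matrix.diagonal ![(0 : ℝ), -2]) *ᵥ v ≤
            w ⬝ᵥ (Matrix.diagonal ![(0 : ℝ), 1] + t • Matrix.diagonal ![(0 : ℝ), -2]) *ᵥ w) →
        1 ≤ v ⬝ᵥ Matrix.diagonal ![(1 : ℝ), 0] *ᵥ v := by
    refine ⟨1 / 4, by norm_num, ?_⟩
    rintro t ⟨ht0, ht1⟩ v ⟨hn, hmin⟩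
    have h1 := hmin ![1, 0] (by simp [dotProduct, Fin.sum_univ_two])
    rw [toy_form, toy_form] at h1
    rw [toy_norm] at hn
    rw [toy_formP]
    simp at h1
    have h2t : 0 < 1 - 2 * t := by linarith
    have hv1 : v 1 ^ 2 ≤ 0 := by
      by_contra hc
      push Not at hc
      have := mul_pos h2t hc
      linarith
    nlinarith [sq_nonneg (v 1)]
  have hgs : (![0, 1] : Fin 2 → ℝ) ⬝ᵥ ![0, 1] = 1 ∧ ∀ w : Fin 2 → ℝ, w ⬝ᵥ w = 1 →
      ![0, 1] ⬝ᵥ (Matrix.diagonal ![(0 : ℝ), 1] + Matrix.diagonal ![(0 : ℝ), -2]) *ᵥ ![0, 1] ≤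
        w ⬝ᵥ (Matrix.diagonal ![(0 : ℝ), 1] + Matrix.diagonal ![(0 : ℝ), -2]) *ᵥ w := by
    refine ⟨by simp [dotProduct, Fin.sum_univ_two], fun w hw => ?_⟩
    rw [toy_form1, toy_form1]
    rw [toy_norm] at hw
    have h01 : ((![0, 1] : Fin 2 → ℝ) 1) = 1 := by simp
    rw [h01]
    nlinarith [sq_nonneg (w 0), sq_nonneg (w 1)]
  have := h _ _ _ hP hlit ![0, 1] hgs
  rw [toy_formP] at this
  simp at this

/-! ## 4. Even the two-ended (self-dual) shape is false (3 × 3) -/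

theorem toy3_formXY (t : ℝ) (v : Fin 3 → ℝ) :
    v ⬝ᵥ (Matrix.diagonal ![(-1 : ℝ), 1, -1/10] + t • Matrix.diagonal ![(1 : ℝ), -1, -1/10]) *ᵥ v =
      (-1 + t) * v 0 ^ 2 + (1 - t) * v 1 ^ 2 + (-1/10 - t/10) * v 2 ^ 2 := by
  simp [Matrix.mulVec, dotProduct, Fin.sum_univ_three, Matrix.diagonal, Matrix.add_apply]
  ring

theorem toy3_formYX (t : ℝ) (v : Fin 3 → ℝ) :
    v ⬝ᵥ (t • Matrix.diagonal ![(-1 : ℝ), 1, -1/10] + Matrix.diagonal ![(1 : ℝ), -1, -1/10]) *ᵥ v =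
      (1 - t) * v 0 ^ 2 + (-1 + t) * v 1 ^ 2 + (-1/10 - t/10) * v 2 ^ 2 := by
  simp [Matrix.mulVec, dotProduct, Fin.sum_univ_three, Matrix.diagonal, Matrix.add_apply]
  ring

theorem toy3_form11 (v : Fin 3 → ℝ) :
    v ⬝ᵥ (Matrix.diagonal ![(-1 : ℝ), 1, -1/10] + Matrix.diagonal ![(1 : ℝ), -1, -1/10]) *ᵥ v =
      (-1/5) * v 2 ^ 2 := by
  simp [Matrix.mulVec, dotProduct, Fin.sum_univ_three, Matrix.diagonal, Matrix.add_apply]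
  ring

theorem toy3_formP (v : Fin 3 → ℝ) : v ⬝ᵥ Matrix.diagonal ![(1 : ℝ), 1, 0] *ᵥ v = v 0 ^ 2 + v 1 ^ 2 := by
  simp [Matrix.mulVec, dotProduct, Fin.sum_univ_three, Matrix.diagonal]
  ring

theorem toy3_norm (v : Fin 3 → ℝ) : v ⬝ᵥ v = v 0 ^ 2 + v 1 ^ 2 + v 2 ^ 2 := by
  simp [dotProduct, Fin.sum_univ_three]
  ring

/-- **The abstract two-ended shape is FALSE.** With `X = diag(-1, 1, -1/10)`, `Y = diag(1, -1, -1/10)`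
(exchanged by the swap `0 ↔ 1`, the abstract "duality"), `P = diag(1,1,0) ≥ 0` (swap-invariant): for all
`t ∈ (0, 1/2)` every unit minimiser of `X + tY` AND of `tX + Y` has `⟨P⟩ = 1`, yet the unit minimiser
`e₂` of the self-dual point `X + Y = diag(0,0,-1/5)` has `⟨P⟩ = 0`. So "order at both arms of the
breathing square ⟹ order at the uniform point" is not a principle of linear algebra; the breathing
self-duality `H(a,b,U) ≅ H(b,a,U)` gives no continuation by itself. [folklore] -/
theorem not_abstractTwoEndedShape :
    ¬ (∀ (X Y P : Matrix (Fin 3) (Fin 3) ℝ), P.PosSemidef →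
        (∃ t₀ : ℝ, 0 < t₀ ∧ ∀ t ∈ Set.Ioo (0:ℝ) t₀,
          (∀ v : Fin 3 → ℝ, (v ⬝ᵥ v = 1 ∧ ∀ w : Fin 3 → ℝ, w ⬝ᵥ w = 1 →
              v ⬝ᵥ (X + t • Y) *ᵥ v ≤ w ⬝ᵥ (X + t • Y) *ᵥ w) → 1 ≤ v ⬝ᵥ P *ᵥ v) ∧
          (∀ v : Fin 3 → ℝ, (v ⬝ᵥ v = 1 ∧ ∀ w : Fin 3 → ℝ, w ⬝ᵥ w = 1 →
              v ⬝ᵥ (t • X + Y) *ᵥ v ≤ w ⬝ᵥ (t • X + Y) *ᵥ w) → 1 ≤ v ⬝ᵥ P *ᵥ v)) →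
        ∀ v : Fin 3 → ℝ, (v ⬝ᵥ v = 1 ∧ ∀ w : Fin 3 → ℝ, w ⬝ᵥ w = 1 →
            v ⬝ᵥ (X + Y) *ᵥ v ≤ w ⬝ᵥ (X + Y) *ᵥ w) → 0 < v ⬝ᵥ P *ᵥ v) := by
  intro h
  set X : Matrix (Fin 3) (Fin 3) ℝ := Matrix.diagonal ![(-1 : ℝ), 1, -1/10] with hX
  set Y : Matrix (Fin 3) (Fin 3) ℝ := Matrix.diagonal ![(1 : ℝ), -1, -1/10] with hY
  set P : Matrix (Fin 3) (Fin 3) ℝ := Matrix.diagonal ![(1 : ℝ), 1, 0] with hP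
  have hPsd : P.PosSemidef :=
    Matrix.PosSemidef.diagonal (by intro i; fin_cases i <;> simp)
  have hlit : ∃ t₀ : ℝ, 0 < t₀ ∧ ∀ t ∈ Set.Ioo (0:ℝ) t₀,
      (∀ v : Fin 3 → ℝ, (v ⬝ᵥ v = 1 ∧ ∀ w : Fin 3 → ℝ, w ⬝ᵥ w = 1 →
          v ⬝ᵥ (X + t • Y) *ᵥ v ≤ w ⬝ᵥ (X + t • Y) *ᵥ w) → 1 ≤ v ⬝ᵥ P *ᵥ v) ∧
      (∀ v : Fin 3 → ℝ, (v ⬝ᵥ v = 1 ∧ ∀ w : Fin 3 → ℝ, w ⬝ᵥ w = 1 →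
          v ⬝ᵥ (t • X + Y) *ᵥ v ≤ w ⬝ᵥ (t • X + Y) *ᵥ w) → 1 ≤ v ⬝ᵥ P *ᵥ v) := by
    refine ⟨1 / 2, by norm_num, ?_⟩
    rintro t ⟨ht0, ht1⟩
    refine ⟨?_, ?_⟩
    · rintro v ⟨hn, hmin⟩
      have h1 := hmin ![1, 0, 0] (by simp [dotProduct, Fin.sum_univ_three])
      rw [hX, hY, toy3_formXY, toy3_formXY] at h1
      rw [toy3_norm] at hn
      rw [hP, toy3_formP]
      simp at h1
      -- h1 : (-1+t) v0² + (1-t) v1² + (-1/10 - t/10) v2² ≤ -1 + t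
      nlinarith [sq_nonneg (v 0), sq_nonneg (v 1), sq_nonneg (v 2),
        mul_nonneg (show (0:ℝ) ≤ 1 - t by linarith) (sq_nonneg (v 1)),
        mul_nonneg (show (0:ℝ) ≤ 1/2 - t by linarith) (sq_nonneg (v 2)),
        mul_nonneg ht0.le (sq_nonneg (v 0)), mul_nonneg ht0.le (sq_nonneg (v 1)),
        mul_nonneg ht0.le (sq_nonneg (v 2))]
    · rintro v ⟨hn, hmin⟩
      have h1 := hmin ![0, 1, 0] (by simp [dotProduct, Fin.sum_univ_three])
      rw [hX, hY, toy3_formYX, toy3_formYX] at h1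
      rw [toy3_norm] at hn
      rw [hP, toy3_formP]
      simp at h1
      nlinarith [sq_nonneg (v 0), sq_nonneg (v 1), sq_nonneg (v 2),
        mul_nonneg (show (0:ℝ) ≤ 1 - t by linarith) (sq_nonneg (v 0)),
        mul_nonneg (show (0:ℝ) ≤ 1/2 - t by linarith) (sq_nonneg (v 2)),
        mul_nonneg ht0.le (sq_nonneg (v 0)), mul_nonneg ht0.le (sq_nonneg (v 1)),
        mul_nonneg ht0.le (sq_nonneg (v 2))]
  have hgs : (![0, 0, 1] : Fin 3 → ℝ) ⬝ᵥ ![0, 0, 1] = 1 ∧ ∀ w : Fin 3 → ℝ, w ⬝ᵥ w = 1 →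
      ![0, 0, 1] ⬝ᵥ (X + Y) *ᵥ ![0, 0, 1] ≤ w ⬝ᵥ (X + Y) *ᵥ w := by
    refine ⟨by simp [dotProduct, Fin.sum_univ_three], fun w hw => ?_⟩
    rw [hX, hY, toy3_form11, toy3_form11]
    rw [toy3_norm] at hw
    simp
    nlinarith [sq_nonneg (w 0), sq_nonneg (w 1), sq_nonneg (w 2)]
  have := h X Y P hPsd hlit ![0, 0, 1] hgs
  rw [hP, toy3_formP] at this
  simp at this

end Summit.HubbardSuperconductivity.HubbardSuperconductivity.Cruxes.PbContinuation.IdeationR1K2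

end
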